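import Summits.BirchSwinnertonDyer.Rank1Residual.GaloisImage.NineTorsionOrderNineWitness
import Literature.RepresentationTheory.FiniteGroups.InvariantLineOfFixedVectors
import HarnessLib

/-!
# An element of ORDER THREE on `E[9]` FIXING A POINT OF ORDER NINE is trivial on `E[3]` and
# non-scalar on `E[9]`; hence the `3`-adic tower from surj(3) + ONE such element — the second
# half of the "free `C₃ × C₃`" dichotomy at level `9`
# (cell `b2b-bsdres`, team n1011, seat p02 gen 4 — row T-b11 'm = 3: structure of the wild inertia
# on E[9]', file F1a; pure algebra, no reduction hypothesis, no determinant hypothesis)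

HONEST FRAMING (cell `b2b-bsdres`, run/shared/lean/b2b/bsd-rank1-residual/, verbatim in every
file): the goal of the cell is to DELETE the COMBINATION-SHAPED residual classes of the
Birch–Swinnerton-Dyer formula for ALL analytic-rank `≤ 1` elliptic curves over `ℚ` — "full BSD
formula for every rank `≤ 1` curve in class `C`" assembled STRICTLY from published theorems — so
that the rank-`≤ 1` remainder becomes exactly the CONSTRUCTION-SHAPED classes, which are TYPED
(missing-input `Prop`s), NOT attempted. This is not "finishing BSD". Team n1011 (N10 / N11):
research route; no claim beyond the stated classes; labels UNCHANGED; nothing is booked. Theorems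
only (no definition, no named fact).

## What this file proves

Let `E = W/ℚ` be an elliptic curve and `σ ∈ Γ_ℚ` with `σ³ = 1` on `E[9]` (`h9`) fixing a point
`Q₀ ∈ E[9]` of order nine (`hQ₀ : σ • Q₀ = Q₀`, `h3Q₀ : 3 • Q₀ ≠ 0`).  Then

* `smul_eq_self_three_of_pow_three_of_fixed` (§1) — **`σ = 1` on `E[3]`**.  Matrix shadow: an
  element of `GL₂(ℤ/9)` of order `3` outside the kernel `1 + 3M₂(ℤ/9)` fixes NO vector of order `9`
  (all `216` such elements; seat check `m3/gl2z9.py` (b)).  Matrix-free proof: `N = σ − 1` has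
  `N² = 0` on the `𝔽₃`-plane `A = E[3]` (F0 `smul_smul_sub_eq_of_pow_three_smul_eq`) and
  `N(3Q₀) = 0`; if `N|A ≠ 0` then `im N|A = ker N|A = 𝔽₃·(3Q₀)`
  (`range_eq_ker_of_mul_self_eq_zero`, `eq_of_finrank_eq_one_of_mem`), so for `Q ∈ E[9]`:
  `3·NQ = N(3Q) = 3k·Q₀`, `NQ − k·Q₀ ∈ A`, `N²Q = N(NQ − kQ₀) ∈ ker N|A`, `N³Q = 0`; with `σ³ = 1`
  on `E[9]`, `3N = −3N² − N³ = 0` on `E[9]`, so `N` kills `A = 3·E[9]` — absurd.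
* `not_exists_scalar_of_fixed_of_ne` (§2) — if moreover `σ ≠ 1` on `E[9]`, `σ` is not a scalar
  `1 + 3m` on `E[9]` (a scalar fixing a point of order `9` is `1` on `E[9]`).
* `towerSurj_three_of_surj_of_pow_three_of_fixed` (§3) — with `ρ̄_{E,3}` onto: surj(3) + ONE
  `σ ∈ Γ_ℚ` with `σ³ = 1 ≠ σ` on `E[9]` fixing a point of order nine ⟹ `ρ̄_{E,3ⁿ}` onto for
  every `n` (n1011-p02 gen 2's
  `forall_hasSurjectiveModNGaloisRep_three_pow_of_fixing_torsion_of_nonscalar`, p252833);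
  `imageContainsSL2_three_of_surj_of_pow_three_of_fixed` (Kato (12.5.2));
  `smul_eq_self_nine_of_fixed_of_surj_of_not_surj_nine` (contrapositive: on an EXOTIC row a
  `3`-element of `ρ̄₉(Γ_ℚ)` with a fixed point of order `9` is trivial — the `3`-elements act
  FREELY on `E[9] ∖ E[3]`).

With F0 (`towerSurj_three_of_surj_of_orderNine`: an element of order nine gives the tower) this is
the kernel form of the level-`9` DICHOTOMY of row T-b11: if `ρ̄_{E,3}` is onto and the tower fails,
every `σ ∈ Γ_ℚ` mapping to a `3`-element of `Aut E[9]` satisfies `σ³ = 1` on `E[9]` and, if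
non-trivial there, moves EVERY point of order `9`.  Use at `3` (row T-b11 F2): a valuation class of
`≤ 8` points of order `9` is inertia-stable, so once `9 ∣ #ρ̄₉(I₃)` (gen 3) some `3`-element of
inertia fixes a point of order `9`.  Nothing booked; no label change.

References: [SerreAbelianLadic1968] Ch. IV §3.4 Lemma 3 (IV-23); [Serre1972] §4.1; [Elkies2006]
N. D. Elkies, arXiv:math/0612734, §1 (the lift `G ≅ SL₂(𝔽₃)` of `SL₂(ℤ/3)` to `SL₂(ℤ/9)` meets
the cusp stabilisers `{±(1 a; 0 1)}` trivially); [Kato2004Asterisque] (12.5.2) p. 222.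
-/

noncomputable section

open scoped Classical
open WeierstrassCurve Literature.NumberTheory.EllipticCurves
open Literature.RepresentationTheory.FiniteGroups.Representation

namespace Summit.BirchSwinnertonDyer.Rank1Residual.GaloisImage

variable (W : WeierstrassCurve ℚ) [W.IsElliptic]

omit [W.IsElliptic] in
/-- `E[n]` is `Γ_ℚ`-stable. [folklore] -/
private theorem smul_mem_geomTorsion₁ {n : ℤ} (σ : Field.absoluteGaloisGroup ℚ) {P : W.geomPoints}
    (hP : P ∈ geomTorsion W n) : σ • P ∈ geomTorsion W n :=
  Literature.NumberTheory.EllipticCurves.smul_mem_torsionBy σ hP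

omit [W.IsElliptic] in
/-- Membership in `E[n]` as an equation. [folklore] -/
private theorem zsmul_eq_zero_of_mem₁ {n : ℤ} {P : W.geomPoints} (hP : P ∈ geomTorsion W n) :
    n • P = 0 :=
  (Submodule.mem_torsionBy_iff _ _).mp hP

omit [W.IsElliptic] in
/-- `X ∈ E[3] ↔ 3·X = 0` (natural-number form). [folklore] -/
private theorem mem_three_iff₁ (X : W.geomPoints) : X ∈ geomTorsion W 3 ↔ (3 : ℕ) • X = 0 := by
  rw [show geomTorsion W 3 = geomTorsion W ((3 : ℕ) : ℤ) by norm_num]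
  exact (Submodule.mem_torsionBy_iff _ _).trans (by rw [natCast_zsmul])

/-! ### §1 A `3`-element of `Aut E[9]` fixing a point of order nine is trivial on `E[3]` -/

/-- **Order three on `E[9]` + a fixed point of order nine ⟹ trivial on `E[3]`.**  If
`σ³ = 1` on `E[9]` and `σ Q₀ = Q₀` for some `Q₀ ∈ E[9]` with `3Q₀ ≠ 0`, then `σ` fixes `E[3]`
pointwise (matrix shadow: an element of `GL₂(ℤ/9)` of order `3` outside `1 + 3M₂` fixes no vector
of order `9`; proof in the module docstring). [cite: Serre1972, §4.1] [cite: Elkies2006, §1] -/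
theorem smul_eq_self_three_of_pow_three_of_fixed (σ : Field.absoluteGaloisGroup ℚ)
    (h9 : ∀ Q ∈ geomTorsion W 9, σ ^ 3 • Q = Q) {Q₀ : W.geomPoints} (hQ₀9 : Q₀ ∈ geomTorsion W 9)
    (hQ₀ : σ • Q₀ = Q₀) (h3Q₀ : (3 : ℕ) • Q₀ ≠ 0) : ∀ P ∈ geomTorsion W 3, σ • P = P := by
  haveI : Fact (Nat.Prime 3) := ⟨Nat.prime_three⟩
  -- notation `N X = σ X − X`
  set N : W.geomPoints → W.geomPoints := fun X ↦ σ • X - X with hNdef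
  have hN : ∀ X, N X = σ • X - X := fun X ↦ rfl
  have hNsub : ∀ X Y, N (X - Y) = N X - N Y := fun X Y ↦ by simp only [hN, smul_sub]; abel
  have hNn : ∀ (k : ℕ) X, N (k • X) = k • N X := fun k X ↦ by simp only [hN, smul_comm σ k X, smul_sub]
  -- bookkeeping
  have h9Q : ∀ Q ∈ geomTorsion W 9, (9 : ℕ) • Q = 0 := fun Q hQ ↦ by
    have h := zsmul_eq_zero_of_mem₁ W hQ
    rwa [show (9 : ℤ) = ((9 : ℕ) : ℤ) by norm_num, natCast_zsmul] at h
  have h3Q : ∀ Q ∈ geomTorsion W 9, (3 : ℕ) • Q ∈ geomTorsion W 3 := fun Q hQ ↦ by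
    rw [mem_three_iff₁, ← mul_smul, show (3 : ℕ) * 3 = 9 by norm_num]; exact h9Q Q hQ
  have hmem3_9 : ∀ P ∈ geomTorsion W 3, P ∈ geomTorsion W 9 := fun P hP ↦ by
    apply (Submodule.mem_torsionBy_iff _ _).mpr
    rw [show (9 : ℤ) = 3 * 3 by norm_num, mul_smul, zsmul_eq_zero_of_mem₁ W hP, smul_zero]
  have hmem9N : ∀ Q ∈ geomTorsion W 9, N Q ∈ geomTorsion W 9 := fun Q hQ ↦
    (geomTorsion W 9).sub_mem (smul_mem_geomTorsion₁ W σ hQ) hQ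
  have hmem3N : ∀ P ∈ geomTorsion W 3, N P ∈ geomTorsion W 3 := fun P hP ↦
    (geomTorsion W 3).sub_mem (smul_mem_geomTorsion₁ W σ hP) hP
  -- `σ³ = 1` on `E[3]`, hence `N² = 0` on `E[3]` (F0 §1)
  have h3 : ∀ P ∈ geomTorsion W 3, σ ^ 3 • P = P := fun P hP ↦ h9 P (hmem3_9 P hP)
  have hNN3 : ∀ P ∈ geomTorsion W 3, N (N P) = 0 := fun P hP ↦ by
    have h := smul_smul_sub_eq_of_pow_three_smul_eq W σ h3 P hP
    simpa only [hN] using h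
  -- `P₀ = 3Q₀ ∈ E[3]`, non-zero, killed by `N`
  set P₀ : W.geomPoints := (3 : ℕ) • Q₀ with hP₀def
  have hP₀3 : P₀ ∈ geomTorsion W 3 := h3Q Q₀ hQ₀9
  have hNP₀ : N P₀ = 0 := by rw [hP₀def, hNn, hN, hQ₀, sub_self, smul_zero]
  -- Suppose `N ≠ 0` on `E[3]`; derive a contradiction.
  by_contra hne
  push Not at hne
  obtain ⟨P₁, hP₁, hP₁ne⟩ := hne
  have hNP₁ : N P₁ ≠ 0 := fun h ↦ hP₁ne (by rw [hN, sub_eq_zero] at h; exact h)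
  -- the plane `A = E[3]` over `𝔽₃` and the endomorphism `φ = N|A`
  have h3A : ∀ x : geomTorsion W 3, (3 : ℕ) • x = 0 := fun x ↦ by
    apply Subtype.ext
    have h := zsmul_eq_zero_of_mem₁ W x.2
    have h' : ((3 : ℕ) : ℤ) • (x : W.geomPoints) = 0 := by exact_mod_cast h
    rw [natCast_zsmul] at h'
    exact h'
  letI : Module (ZMod 3) (geomTorsion W 3) := AddCommGroup.zmodModule h3A
  have hcard : Nat.card (geomTorsion W 3) = 3 ^ 2 := by
    have h : Nat.card (geomTorsion W ((3 : ℕ) : ℤ)) = 3 ^ 2 :=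
      card_torsionPoints_eq_sq_holds W (AlgebraicClosure ℚ) (n := 3) (by norm_num)
    exact_mod_cast h
  have hrank : Module.finrank (ZMod 3) (geomTorsion W 3) = 2 := finrank_eq_two_of_natCard_eq_sq hcard
  haveI : FiniteDimensional (ZMod 3) (geomTorsion W 3) := Module.finite_of_finrank_eq_succ hrank
  set u : geomTorsion W 3 →+ geomTorsion W 3 :=
    DistribSMul.toAddMonoidHom (geomTorsion W 3) σ - AddMonoidHom.id _ with hu
  have hu_apply : ∀ x : geomTorsion W 3, ((u x : geomTorsion W 3) : W.geomPoints) = N x := fun x ↦ rfl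
  set φ : geomTorsion W 3 →ₗ[ZMod 3] geomTorsion W 3 := u.toZModLinearMap 3 with hφ
  have hφ_apply : ∀ x : geomTorsion W 3, ((φ x : geomTorsion W 3) : W.geomPoints) = N x := fun x ↦ rfl
  have hφ0 : φ ≠ 0 := fun h ↦ hNP₁ (by
    have := congrArg (fun T : geomTorsion W 3 →ₗ[ZMod 3] geomTorsion W 3 ↦ ((T ⟨P₁, hP₁⟩ : _) : W.geomPoints)) h
    simpa only [hφ_apply, LinearMap.zero_apply, ZeroMemClass.coe_zero] using this)
  have hφsq : φ * φ = 0 := by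
    refine LinearMap.ext fun x ↦ Subtype.ext ?_
    rw [Module.End.mul_apply, LinearMap.zero_apply, ZeroMemClass.coe_zero, hφ_apply, hφ_apply]
    exact hNN3 x x.2
  obtain ⟨hRK, hK1⟩ := range_eq_ker_of_mul_self_eq_zero hrank hφ0 hφsq
  -- `ker φ = 𝔽₃ ∙ P₀`
  have hP₀K : (⟨P₀, hP₀3⟩ : geomTorsion W 3) ∈ LinearMap.ker φ := by
    rw [LinearMap.mem_ker]; exact Subtype.ext (by rw [hφ_apply, ZeroMemClass.coe_zero]; exact hNP₀)
  have hP₀ne : (⟨P₀, hP₀3⟩ : geomTorsion W 3) ≠ 0 := fun h ↦ h3Q₀ (congrArg Subtype.val h)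
  have hspan : LinearMap.ker φ = (ZMod 3) ∙ (⟨P₀, hP₀3⟩ : geomTorsion W 3) :=
    eq_of_finrank_eq_one_of_mem hK1 (by rw [finrank_span_singleton hP₀ne]) hP₀ne hP₀K
      (Submodule.mem_span_singleton_self _)
  -- every element of `im φ = ker φ` is a natural multiple of `P₀`
  have hmult : ∀ X ∈ geomTorsion W 3, N X = 0 → ∃ k : ℕ, X = k • P₀ := by
    intro X hX hNX
    have hXK : (⟨X, hX⟩ : geomTorsion W 3) ∈ LinearMap.ker φ := by
      rw [LinearMap.mem_ker]; exact Subtype.ext (by rw [hφ_apply, ZeroMemClass.coe_zero]; exact hNX)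
    rw [hspan, Submodule.mem_span_singleton] at hXK
    obtain ⟨c, hc⟩ := hXK
    refine ⟨c.val, ?_⟩
    have h := congrArg Subtype.val hc
    -- `c • x = c.val • x` in the `ZMod 3`-module structure `AddCommGroup.zmodModule`
    have hcv : ((c • (⟨P₀, hP₀3⟩ : geomTorsion W 3) : geomTorsion W 3) : W.geomPoints) = c.val • P₀ := by
      have e1 : c • (⟨P₀, hP₀3⟩ : geomTorsion W 3) = c.val • (⟨P₀, hP₀3⟩ : geomTorsion W 3) := by
        conv_lhs => rw [← ZMod.natCast_zmod_val c]
        exact Nat.cast_smul_eq_nsmul (ZMod 3) c.val _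
      rw [e1]; rfl
    rw [hcv] at h
    exact h.symm
  have himN : ∀ P ∈ geomTorsion W 3, ∃ k : ℕ, N P = k • P₀ :=
    fun P hP ↦ hmult (N P) (hmem3N P hP) (hNN3 P hP)
  -- for `Q ∈ E[9]`: `N³ Q = 0`
  have hN3 : ∀ Q ∈ geomTorsion W 9, N (N (N Q)) = 0 := by
    intro Q hQ
    obtain ⟨k, hk⟩ := himN ((3 : ℕ) • Q) (h3Q Q hQ)     -- `N(3Q) = k • P₀ = 3k • Q₀`
    have hdiff : N Q - k • Q₀ ∈ geomTorsion W 3 := by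
      rw [mem_three_iff₁, smul_sub, ← hNn, hk, hP₀def, smul_comm (3 : ℕ) k Q₀, sub_self]
    have hNQ : N Q = (N Q - k • Q₀) + k • Q₀ := by abel
    have hNQ₀ : N Q₀ = 0 := by rw [hN, hQ₀, sub_self]
    have hN2 : N (N Q) = N (N Q - k • Q₀) := by
      have hsplit : N (N Q - k • Q₀ + k • Q₀) = N (N Q - k • Q₀) + N (k • Q₀) := by
        simp only [hN, smul_add]; abel
      rw [← hNQ] at hsplit
      rw [hsplit, hNn, hNQ₀, smul_zero, add_zero]
    -- `N (NQ − kQ₀) ∈ ker N|A`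
    rw [hN2]
    exact hNN3 _ hdiff
  -- `σ³ Q = Q + 3 N Q + 3 N² Q + N³ Q`; with `σ³ = 1` and `3N² = 0`, `N³ = 0`: `3 N Q = 0`
  have hcube : ∀ X, σ ^ 3 • X = X + (3 : ℕ) • N X + (3 : ℕ) • N (N X) + N (N (N X)) := fun X ↦ by
    simp only [hN, smul_sub, pow_three, mul_smul]
    abel
  have h3N : ∀ Q ∈ geomTorsion W 9, (3 : ℕ) • N Q = 0 := by
    intro Q hQ
    have h33 : (3 : ℕ) • N (N Q) = 0 := by rw [← hNn, ← hNn]; exact hNN3 _ (h3Q Q hQ)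
    have h := h9 Q hQ
    rw [hcube, h33, hN3 Q hQ, add_zero, add_zero, add_eq_left] at h
    exact h
  -- hence `N = 0` on `E[3] = 3 · E[9]`: contradiction at `P₁`
  obtain ⟨Q₁, hQ₁⟩ := W.zsmul_geomPoints_surjective_holds (n := 3) (by norm_num) P₁
  have hQ₁z : (3 : ℤ) • Q₁ = P₁ := hQ₁
  have hQ₁' : (3 : ℕ) • Q₁ = P₁ := by
    rw [show (3 : ℤ) = ((3 : ℕ) : ℤ) by norm_num, natCast_zsmul] at hQ₁z; exact hQ₁z
  have hQ₁9 : Q₁ ∈ geomTorsion W 9 := by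
    apply (Submodule.mem_torsionBy_iff _ _).mpr
    rw [show (9 : ℤ) = 3 * 3 by norm_num, mul_smul, hQ₁z]
    exact zsmul_eq_zero_of_mem₁ W hP₁
  exact hNP₁ (by rw [← hQ₁', hNn]; exact h3N Q₁ hQ₁9)

/-! ### §2 … and non-scalar on `E[9]` -/

omit [W.IsElliptic] in
/-- **A scalar `1 + 3m` on `E[9]` fixing a point of order nine is trivial on `E[9]`.**  Hence an
element with `σ Q₀ = Q₀` (`3Q₀ ≠ 0`) that moves some point of `E[9]` is not a scalar. [folklore] -/
theorem not_exists_scalar_of_fixed_of_ne (σ : Field.absoluteGaloisGroup ℚ) {Q₀ : W.geomPoints}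
    (hQ₀9 : Q₀ ∈ geomTorsion W 9) (hQ₀ : σ • Q₀ = Q₀) (h3Q₀ : (3 : ℕ) • Q₀ ≠ 0)
    (hne : ∃ Q ∈ geomTorsion W 9, σ • Q ≠ Q) :
    ¬ ∃ m : ℕ, ∀ Q ∈ geomTorsion W 9, σ • Q = (1 + 3 * m) • Q := by
  rintro ⟨m, hm⟩
  have h9Q : ∀ Q ∈ geomTorsion W 9, (9 : ℕ) • Q = 0 := fun Q hQ ↦ by
    have h := zsmul_eq_zero_of_mem₁ W hQ
    rwa [show (9 : ℤ) = ((9 : ℕ) : ℤ) by norm_num, natCast_zsmul] at h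
  -- at `Q₀`: `(3m) Q₀ = 0`, so `3 ∣ m` (else `3 Q₀ = 0`)
  have h0 : (3 * m) • Q₀ = 0 := by
    have h := hm Q₀ hQ₀9
    rw [hQ₀, add_smul, one_smul] at h
    exact (add_eq_left.mp h.symm)
  have h3m : 3 ∣ m := by
    by_contra h3m
    have hcop : Nat.Coprime m 3 := ((Nat.Prime.coprime_iff_not_dvd Nat.prime_three).mpr h3m).symm
    obtain ⟨b, -, hb⟩ := Nat.exists_mul_mod_eq_one_of_coprime hcop (by norm_num)
    have hdm : 3 * (m * b / 3) + 1 = m * b := by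
      have := Nat.div_add_mod (m * b) 3
      rwa [hb] at this
    apply h3Q₀
    have h1 : (3 * (m * b)) • Q₀ = 0 := by
      rw [show 3 * (m * b) = b * (3 * m) by ring, mul_smul, h0, smul_zero]
    rw [← hdm, mul_add, mul_one, add_smul, show 3 * (3 * (m * b / 3)) = (m * b / 3) * 9 by ring,
      mul_smul, h9Q Q₀ hQ₀9, smul_zero, zero_add] at h1
    exact h1
  -- then `σ = 1` on `E[9]`, against `hne`
  obtain ⟨Q, hQ, hQne⟩ := hne
  obtain ⟨k, hk⟩ := h3m
  exact hQne (by rw [hm Q hQ, add_smul, one_smul, hk, show 3 * (3 * k) = k * 9 by ring, mul_smul,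
    h9Q Q hQ, smul_zero, add_zero])

/-- **The witness, packaged.**  `σ³ = 1 ≠ σ` on `E[9]` with a fixed point of order nine gives the
hypotheses `h1`, `hns` of `forall_hasSurjectiveModNGaloisRep_three_pow_of_fixing_torsion_of_nonscalar`
for `τ = σ`. [cite: Serre1972, §4.1] -/
theorem fixing_three_and_nonscalar_of_pow_three_of_fixed (σ : Field.absoluteGaloisGroup ℚ)
    (h9 : ∀ Q ∈ geomTorsion W 9, σ ^ 3 • Q = Q) (hne : ∃ Q ∈ geomTorsion W 9, σ • Q ≠ Q)
    {Q₀ : W.geomPoints} (hQ₀9 : Q₀ ∈ geomTorsion W 9) (hQ₀ : σ • Q₀ = Q₀) (h3Q₀ : (3 : ℕ) • Q₀ ≠ 0) :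
    (∀ P ∈ geomTorsion W 3, σ • P = P) ∧
      ¬ ∃ m : ℕ, ∀ Q ∈ geomTorsion W 9, σ • Q = (1 + 3 * m) • Q :=
  ⟨smul_eq_self_three_of_pow_three_of_fixed W σ h9 hQ₀9 hQ₀ h3Q₀,
    not_exists_scalar_of_fixed_of_ne W σ hQ₀9 hQ₀ h3Q₀ hne⟩

/-! ### §3 The tower, Kato's (12.5.2), and the EXOTIC contrapositive -/

/-- **The `3`-adic tower from surj(3) and ONE `3`-element of `Aut E[9]` with a fixed point of order
nine.**  If `ρ̄_{E,3}` is onto and some `σ ∈ Γ_ℚ` has `σ³ = 1` on `E[9]`, moves some point of `E[9]`,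
and fixes a point `Q₀` of order `9`, then `ρ̄_{E,3ⁿ}` is onto for every `n`.
[cite: SerreAbelianLadic1968, Ch. IV §3.4, Lemma 3 (IV-23)] [cite: Elkies2006, §1] -/
theorem towerSurj_three_of_surj_of_pow_three_of_fixed (hsurj : W.HasSurjectiveModNGaloisRep 3)
    (σ : Field.absoluteGaloisGroup ℚ) (h9 : ∀ Q ∈ geomTorsion W 9, σ ^ 3 • Q = Q)
    (hne : ∃ Q ∈ geomTorsion W 9, σ • Q ≠ Q) {Q₀ : W.geomPoints} (hQ₀9 : Q₀ ∈ geomTorsion W 9)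
    (hQ₀ : σ • Q₀ = Q₀) (h3Q₀ : (3 : ℕ) • Q₀ ≠ 0) (n : ℕ) : W.HasSurjectiveModNGaloisRep (3 ^ n : ℕ) := by
  obtain ⟨h1, hns⟩ := fixing_three_and_nonscalar_of_pow_three_of_fixed W σ h9 hne hQ₀9 hQ₀ h3Q₀
  exact W.forall_hasSurjectiveModNGaloisRep_three_pow_of_fixing_torsion_of_nonscalar hsurj σ h1 hns n

/-- **Kato's (12.5.2) at `3`** from surj(3) and one `3`-element of `Aut E[9]` with a fixed point of
order nine. [cite: Kato2004Asterisque, (12.5.2) (p. 222)] [cite: SerreAbelianLadic1968, Ch. IV §3.4, Lemma 3 (IV-23)] -/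
theorem imageContainsSL2_three_of_surj_of_pow_three_of_fixed (hsurj : W.HasSurjectiveModNGaloisRep 3)
    (σ : Field.absoluteGaloisGroup ℚ) (h9 : ∀ Q ∈ geomTorsion W 9, σ ^ 3 • Q = Q)
    (hne : ∃ Q ∈ geomTorsion W 9, σ • Q ≠ Q) {Q₀ : W.geomPoints} (hQ₀9 : Q₀ ∈ geomTorsion W 9)
    (hQ₀ : σ • Q₀ = Q₀) (h3Q₀ : (3 : ℕ) • Q₀ ≠ 0) : Kato2004.ImageContainsSL2 W 3 := by
  haveI : Fact (Nat.Prime 3) := ⟨Nat.prime_three⟩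
  exact (Kato2004.imageContainsSL2_iff_forall_hasSurjectiveModNGaloisRep W 3).mpr
    (towerSurj_three_of_surj_of_pow_three_of_fixed W hsurj σ h9 hne hQ₀9 hQ₀ h3Q₀)

/-- **On an EXOTIC row the `3`-elements of `ρ̄₉(Γ_ℚ)` act freely on the points of order nine**:
if `ρ̄_{E,3}` is onto and `ρ̄_{E,9}` is not, then any `σ ∈ Γ_ℚ` with `σ³ = 1` on `E[9]` that fixes a
point of order `9` is trivial on `E[9]`. [cite: Elkies2006, §1–§2] -/
theorem smul_eq_self_nine_of_fixed_of_surj_of_not_surj_nine (hsurj : W.HasSurjectiveModNGaloisRep 3)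
    (hnot : ¬ W.HasSurjectiveModNGaloisRep 9) (σ : Field.absoluteGaloisGroup ℚ)
    (h9 : ∀ Q ∈ geomTorsion W 9, σ ^ 3 • Q = Q) {Q₀ : W.geomPoints} (hQ₀9 : Q₀ ∈ geomTorsion W 9)
    (hQ₀ : σ • Q₀ = Q₀) (h3Q₀ : (3 : ℕ) • Q₀ ≠ 0) : ∀ Q ∈ geomTorsion W 9, σ • Q = Q := by
  by_contra h
  push Not at h
  obtain ⟨Q, hQ, hQne⟩ := h
  exact hnot (by
    simpa using towerSurj_three_of_surj_of_pow_three_of_fixed W hsurj σ h9 ⟨Q, hQ, hQne⟩ hQ₀9 hQ₀ h3Q₀ 2)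

end Summit.BirchSwinnertonDyer.Rank1Residual.GaloisImage

end
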